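import Summits.KontsevichZagierPeriods.Zeta5Search.Barrier.ConeGammaFarSlicePoint

/-!
# ζ(5) search — BARRIER: `C₀` TO FIRST ORDER IN THE FAR CHART — soundness II: `K_c(X_c, ·)` from below on `Z`

HONEST FRAMING (cell `pub-zeta5`): systematic search; no irrationality claim unless kernel-certified. Theorems only. MODEL
objects under Brown–Zudilin's (28)+(30) ((28) observed, not proved): the resolved `Y`-part `K = H/z` of cert-2 g39's value
function in cert-2 g38's far chart (`FarSlice.valH`, `valK`) and the checker `ConeGammaFarSliceCheck` (`lamPiece`,
`quadNonnegOn`, `kPieceLo`, `kMin`). Nothing here is a statement about the size of any critical value of record, any γ, the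
cone's supremum (C2 OPEN), S-E (CONJECTURED), (TD_A) or `ζ(5)`; no number of record moves; records in print UNMOVED. Theory seat
cert-2 g40 (item «C₀ TO FIRST ORDER IN THE FAR CHART — THE CENTRE-SLICE CERTIFICATE», part 3b).

* `valHL_tangent` — `H(z) − H(a) − (z − a)·η(a) = Σ σ_k·tanD(β′_k + a m_k, β′_k + z m_k)`;
* `lamPiece_sound` — the per-form quadratic bounds (cert-2 g39's `xlnx_tangent_quad_pos/neg` through `FarSlice.tanD_le_of_pos`
  &c.) summed: `H(z) − H(a) − (z − a)η(a) ≤ λ⁺(z − a)²` resp. `≥ λ⁻(z − a)²` on a z-piece;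
(`valH_zero`, `quadNonnegOn_sound`, `kPieceLo_sound`, `kMin_sound` are in `ConeGammaFarSliceKminCert`.)
-/

open Finset Set
open Literature.Analysis.ValidatedNumerics.NumericsMP

namespace Summit.KontsevichZagierPeriods.Zeta5Search.Barrier.ConeGamma

namespace FarSlice

open LemmaFBox (SC SC_pos coef featVal minNum maxNum box centre centre_mem minNum_add_maxNum)
open Envelope (EForm formVal vforms valF valueV)

/-! ### The tangent identity and the per-form quadratic bounds for `H` -/

/-- **Tangent identity for `H`**: `H(z) − H(a) − (z − a)·η(a) = Σ_k σ_k·tanD(β′_k + a m_k, β′_k + z m_k)`. -/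
theorem valHL_tangent (s : Fin 8 → ℝ) (X a z : ℝ) : ∀ F : List KForm,
    valHL F s X z - valHL F s X a - (z - a) * etaL F s X a
      = (F.map fun f => (f.sg : ℝ) * tanD ((f.bp : ℝ) + a * mval f s X) ((f.bp : ℝ) + z * mval f s X)).sum
  | [] => by simp [valHL, etaL]
  | f :: F => by
    rw [valHL_cons, valHL_cons, etaL_cons, List.map_cons, List.sum_cons, ← valHL_tangent s X a z F]
    unfold tanD
    ring

/-- `((w.natAbs : ℕ) : ℚ)` cast to `ℝ` is `|w|`. -/
theorem cast_natAbs_real (w : ℤ) : (((w.natAbs : ℕ) : ℚ) : ℝ) = |(w : ℝ)| := by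
  rw [Rat.cast_natCast, Nat.cast_natAbs, Int.cast_abs]

/-- On a z-piece the resolved form at the centre interpolates its endpoint values: for `za ≤ ζ·zden ≤ zb`,
`(β′ + ζ m)·(Q·zden)` lies between `wa = wAt za` and `wb = wAt zb`; with `wa·wb > 0` it has their sign and modulus in
`[min(|wa|,|wb|), max(|wa|,|wb|)]/(Q·zden)`. -/
theorem kval_piece_bounds {D T : ℕ} (hD : 0 < D) (hT : 0 < T) (lo hi : List ℕ) (xc : ℤ) {zden : ℕ} (hzden : 0 < zden)
    {za zb : ℤ} (f : KForm) (hpos : 0 < wAt (2 * D * T) T lo hi xc zden za f * wAt (2 * D * T) T lo hi xc zden zb f)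
    {ζ : ℝ} (hζ : ζ ∈ zSeg zden za zb) :
    let w := (f.bp : ℝ) + ζ * mval f (centre D lo hi) ((xc : ℝ) / (2 * D * T))
    let N : ℝ := ((2 * D * T : ℕ) : ℝ) * zden
    let wa : ℝ := (wAt (2 * D * T) T lo hi xc zden za f : ℝ)
    let wb : ℝ := (wAt (2 * D * T) T lo hi xc zden zb f : ℝ)
    min |wa| |wb| / N ≤ |w| ∧ |w| ≤ max |wa| |wb| / N ∧ (0 < wa → 0 < w) ∧ (wa < 0 → w < 0) := by
  intro w N wa wb
  have hN : 0 < N := by show (0 : ℝ) < ((2 * D * T : ℕ) : ℝ) * zden; positivity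
  have hm := mval_centre hD hT lo hi xc f
  have ewN : w * N = ((2 * D * T : ℕ) : ℝ) * zden * f.bp + (ζ * zden) * (mcN T lo hi xc f : ℝ) := by
    show ((f.bp : ℝ) + ζ * mval f (centre D lo hi) ((xc : ℝ) / (2 * D * T))) * (((2 * D * T : ℕ) : ℝ) * zden) = _
    rw [← hm]; push_cast; ring
  have ewa : wa = ((2 * D * T : ℕ) : ℝ) * zden * f.bp + (za : ℝ) * (mcN T lo hi xc f : ℝ) := by
    show ((wAt (2 * D * T) T lo hi xc zden za f : ℤ) : ℝ) = _; unfold wAt; push_cast; ring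
  have ewb : wb = ((2 * D * T : ℕ) : ℝ) * zden * f.bp + (zb : ℝ) * (mcN T lo hi xc f : ℝ) := by
    show ((wAt (2 * D * T) T lo hi xc zden zb f : ℤ) : ℝ) = _; unfold wAt; push_cast; ring
  have hbetween : min wa wb ≤ w * N ∧ w * N ≤ max wa wb := by
    rw [ewN, ewa, ewb]
    obtain ⟨h1, h2⟩ := hζ
    rcases le_or_gt 0 (mcN T lo hi xc f : ℝ) with hc | hc
    · have a1 := mul_le_mul_of_nonneg_right h1 hc
      have a2 := mul_le_mul_of_nonneg_right h2 hc
      exact ⟨(min_le_left _ _).trans (by linarith), le_trans (by linarith) (le_max_right _ _)⟩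
    · have a1 := mul_le_mul_of_nonpos_right h1 hc.le
      have a2 := mul_le_mul_of_nonpos_right h2 hc.le
      exact ⟨(min_le_right _ _).trans (by linarith), le_trans (by linarith) (le_max_left _ _)⟩
  have hpos' : 0 < wa * wb := by
    show (0 : ℝ) < ((wAt (2 * D * T) T lo hi xc zden za f : ℤ) : ℝ) * ((wAt (2 * D * T) T lo hi xc zden zb f : ℤ) : ℝ)
    exact_mod_cast hpos
  rw [div_le_iff₀ hN, le_div_iff₀ hN]
  have habs : |w| * N = |w * N| := by rw [abs_mul, abs_of_pos hN]
  rw [habs]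
  by_cases ha : 0 < wa
  · have hb : 0 < wb := by
      by_contra hcon; push Not at hcon; nlinarith
    have hwN : 0 < w * N := lt_of_lt_of_le (lt_min ha hb) hbetween.1
    refine ⟨?_, ?_, fun _ => (mul_pos_iff_of_pos_right hN).mp hwN, fun h => absurd ha (not_lt.mpr h.le)⟩
    · rw [abs_of_pos hwN, abs_of_pos ha, abs_of_pos hb]; exact hbetween.1
    · rw [abs_of_pos hwN, abs_of_pos ha, abs_of_pos hb]; exact hbetween.2
  · push Not at ha
    have ha' : wa < 0 := lt_of_le_of_ne ha (by intro h0; rw [h0] at hpos'; simp at hpos')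
    have hb : wb < 0 := by
      by_contra hcon; push Not at hcon; nlinarith
    have hwN : w * N < 0 := lt_of_le_of_lt hbetween.2 (max_lt ha' hb)
    have hw : w < 0 := by
      by_contra hcon; push Not at hcon; nlinarith [mul_nonneg hcon hN.le]
    refine ⟨?_, ?_, fun h => absurd ha' (not_lt.mpr h.le), fun _ => hw⟩
    · rw [abs_of_neg hwN, abs_of_neg ha', abs_of_neg hb]
      have := hbetween.2
      rcases le_total wa wb with h | h
      · rw [max_eq_right h] at this; rw [min_eq_right (by linarith : -wb ≤ -wa)]; linarith
      · rw [max_eq_left h] at this; rw [min_eq_left (by linarith : -wa ≤ -wb)]; linarith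
    · rw [abs_of_neg hwN, abs_of_neg ha', abs_of_neg hb]
      have := hbetween.1
      rcases le_total wa wb with h | h
      · rw [min_eq_left h] at this; rw [max_eq_left (by linarith : -wb ≤ -wa)]; linarith
      · rw [min_eq_right h] at this; rw [max_eq_right (by linarith : -wa ≤ -wb)]; linarith

/-- One `Y`-form on a z-piece: the one-sided quadratic bounds of `σ·tanD` with the checker's weights `rhoUp` / `rhoLo`
(`S = Q·zden`, `mN = min(|wa|, |wb|)`, `MN = max(|wa|, |wb|)`; `σ = ±1`). -/
theorem kform_tanD_bounds {D T : ℕ} (hD : 0 < D) (hT : 0 < T) (lo hi : List ℕ) (xc : ℤ) {zden : ℕ} (hzden : 0 < zden)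
    {za zb : ℤ} (f : KForm) (hsg : f.sg = 1 ∨ f.sg = -1)
    (hpos : 0 < wAt (2 * D * T) T lo hi xc zden za f * wAt (2 * D * T) T lo hi xc zden zb f)
    {a z : ℝ} (ha : a ∈ zSeg zden za zb) (hz : z ∈ zSeg zden za zb) :
    let X := (xc : ℝ) / (2 * D * T)
    let c := centre D lo hi
    let A := (f.bp : ℝ) + a * mval f c X
    let B := (f.bp : ℝ) + z * mval f c X
    let wa := wAt (2 * D * T) T lo hi xc zden za f
    let wb := wAt (2 * D * T) T lo hi xc zden zb f
    let S : ℚ := ((2 * D * T : ℕ) : ℚ) * zden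
    let mN : ℚ := min (wa.natAbs : ℚ) (wb.natAbs : ℚ)
    let MN : ℚ := max (wa.natAbs : ℚ) (wb.natAbs : ℚ)
    let pos : Bool := decide (0 < f.sg * wa)
    (f.sg : ℝ) * tanD A B ≤ ((rhoUp S mN MN pos : ℚ) : ℝ) * (B - A) ^ 2 ∧
      ((rhoLo S mN MN pos : ℚ) : ℝ) * (B - A) ^ 2 ≤ (f.sg : ℝ) * tanD A B := by
  intro X c A B wa wb S mN MN pos
  obtain ⟨la1, la2, la3, la4⟩ := kval_piece_bounds hD hT lo hi xc hzden f hpos ha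
  obtain ⟨lz1, lz2, lz3, lz4⟩ := kval_piece_bounds hD hT lo hi xc hzden f hpos hz
  set N : ℝ := ((2 * D * T : ℕ) : ℝ) * zden with hNdef
  have hN : 0 < N := by rw [hNdef]; positivity
  have hwa0 : wa ≠ 0 := fun h0 => by simp [wa, h0] at hpos
  have hwb0 : wb ≠ 0 := fun h0 => by simp [wb, h0] at hpos
  set m' : ℝ := min |(wa : ℝ)| |(wb : ℝ)| with hm'
  set M' : ℝ := max |(wa : ℝ)| |(wb : ℝ)| with hM'
  have hm'pos : 0 < m' := lt_min (abs_pos.mpr (by exact_mod_cast hwa0)) (abs_pos.mpr (by exact_mod_cast hwb0))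
  have hM'pos : 0 < M' := lt_of_lt_of_le hm'pos (min_le_max)
  have hm : 0 < m' / N := div_pos hm'pos hN
  have hSR : ((S : ℚ) : ℝ) = N := by simp only [S, hNdef]; push_cast; ring
  have hna : ((wa.natAbs : ℕ) : ℝ) = |(wa : ℝ)| := by rw [Nat.cast_natAbs, Int.cast_abs]
  have hnb : ((wb.natAbs : ℕ) : ℝ) = |(wb : ℝ)| := by rw [Nat.cast_natAbs, Int.cast_abs]
  have hmNR : ((mN : ℚ) : ℝ) = m' := by simp only [mN, hm']; push_cast; rw [hna, hnb]
  have hMNR : ((MN : ℚ) : ℝ) = M' := by simp only [MN, hM']; push_cast; rw [hna, hnb]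
  have eUp : ((rhoUp S mN MN pos : ℚ) : ℝ) = if pos then N / (2 * m') else -N / (2 * M') := by
    unfold rhoUp; split_ifs <;> push_cast <;> rw [hSR] <;> first | rw [hmNR] | rw [hMNR]
  have eLo : ((rhoLo S mN MN pos : ℚ) : ℝ) = if pos then N / (2 * M') else -N / (2 * m') := by
    unfold rhoLo; split_ifs <;> push_cast <;> rw [hSR] <;> first | rw [hMNR] | rw [hmNR]
  rw [eUp, eLo]
  by_cases hp : 0 < f.sg * wa
  · have hpos_t : pos = true := by simp only [pos, hp, decide_true]
    simp only [hpos_t, if_true]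
    rcases hsg with h1 | h1
    · have hwa : 0 < wa := by rw [h1, one_mul] at hp; exact hp
      have hA0 : 0 < A := la3 (by exact_mod_cast hwa)
      have hB0 : 0 < B := lz3 (by exact_mod_cast hwa)
      rw [abs_of_pos hA0] at la1 la2; rw [abs_of_pos hB0] at lz1 lz2
      rw [h1]; push_cast; simp only [one_mul]
      have u := tanD_le_of_pos hm la1 lz1
      have l := (Envelope.xlnx_tangent_quad_pos hm la1 la2 lz1 lz2).1
      constructor
      · calc tanD A B ≤ (B - A) ^ 2 / (2 * (m' / N)) := u
          _ = N / (2 * m') * (B - A) ^ 2 := by field_simp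
      · calc N / (2 * M') * (B - A) ^ 2 = (B - A) ^ 2 / (2 * (M' / N)) := by field_simp
          _ ≤ tanD A B := l
    · have hwa : wa < 0 := by rw [h1] at hp; linarith
      have hA0 : A < 0 := la4 (by exact_mod_cast hwa)
      have hB0 : B < 0 := lz4 (by exact_mod_cast hwa)
      rw [abs_of_neg hA0] at la1 la2; rw [abs_of_neg hB0] at lz1 lz2
      rw [h1]; push_cast
      have u := neg_tanD_le_of_neg hm la1 lz1
      have l := (Envelope.xlnx_tangent_quad_neg hm la1 la2 lz1 lz2).1
      constructor
      · calc (-1 : ℝ) * tanD A B = -tanD A B := by ring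
          _ ≤ (B - A) ^ 2 / (2 * (m' / N)) := u
          _ = N / (2 * m') * (B - A) ^ 2 := by field_simp
      · calc N / (2 * M') * (B - A) ^ 2 = (B - A) ^ 2 / (2 * (M' / N)) := by field_simp
          _ ≤ -tanD A B := by unfold tanD; linarith
          _ = (-1 : ℝ) * tanD A B := by ring
  · have hpos_f : pos = false := by simp only [pos, hp, decide_false]
    simp only [hpos_f, Bool.false_eq_true, if_false]
    rcases hsg with h1 | h1
    · have hwa : wa < 0 := by
        rw [h1, one_mul] at hp; push Not at hp
        exact lt_of_le_of_ne hp hwa0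
      have hA0 : A < 0 := la4 (by exact_mod_cast hwa)
      have hB0 : B < 0 := lz4 (by exact_mod_cast hwa)
      rw [abs_of_neg hA0] at la1 la2; rw [abs_of_neg hB0] at lz1 lz2
      rw [h1]; push_cast; simp only [one_mul]
      have u := tanD_le_of_neg hA0 hB0 la2 lz2
      have l := (Envelope.xlnx_tangent_quad_neg hm la1 la2 lz1 lz2).2
      constructor
      · calc tanD A B ≤ -((B - A) ^ 2 / (2 * (M' / N))) := u
          _ = -N / (2 * M') * (B - A) ^ 2 := by field_simp
      · calc -N / (2 * m') * (B - A) ^ 2 = -((B - A) ^ 2 / (2 * (m' / N))) := by field_simp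
          _ ≤ tanD A B := by unfold tanD; linarith
    · have hwa : 0 < wa := by
        rw [h1] at hp; push Not at hp
        rcases lt_or_gt_of_ne hwa0 with hlt | hgt
        · exfalso; linarith
        · exact hgt
      have hA0 : 0 < A := la3 (by exact_mod_cast hwa)
      have hB0 : 0 < B := lz3 (by exact_mod_cast hwa)
      rw [abs_of_pos hA0] at la1 la2; rw [abs_of_pos hB0] at lz1 lz2
      rw [h1]; push_cast
      have u := neg_tanD_le_of_pos hA0 hB0 la2 lz2
      have l := (Envelope.xlnx_tangent_quad_pos hm la1 la2 lz1 lz2).2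
      constructor
      · calc (-1 : ℝ) * tanD A B = -tanD A B := by ring
          _ ≤ -((B - A) ^ 2 / (2 * (M' / N))) := u
          _ = -N / (2 * M') * (B - A) ^ 2 := by field_simp
      · calc -N / (2 * m') * (B - A) ^ 2 = -((B - A) ^ 2 / (2 * (m' / N))) := by field_simp
          _ ≤ -tanD A B := by unfold tanD; unfold tanD at u; linarith
          _ = (-1 : ℝ) * tanD A B := by ring

/-- **The per-form quadratic bounds summed over a list of `Y`-forms** on a z-piece: with `lamPiece … upper F = some λ`,
for `a`, `z` in the piece, `H_F(z) − H_F(a) − (z − a)·η_F(a) ≤ λ (z − a)²` (`upper = true`) resp. `≥ λ (z − a)²`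
(`upper = false`) at the centre direction and the fixed abscissa. -/
theorem lamPiece_sound {D T : ℕ} (hD : 0 < D) (hT : 0 < T) (lo hi : List ℕ) (xc : ℤ) {zden : ℕ} (hzden : 0 < zden)
    {za zb : ℤ} {a z : ℝ} (ha : a ∈ zSeg zden za zb) (hz : z ∈ zSeg zden za zb) :
    ∀ (upper : Bool) (F : List KForm) {lam : ℚ}, lamPiece (2 * D * T) T lo hi xc zden za zb upper F = some lam →
      (upper = true → valHL F (centre D lo hi) ((xc : ℝ) / (2 * D * T)) z - valHL F (centre D lo hi) ((xc : ℝ) / (2 * D * T)) a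
        - (z - a) * etaL F (centre D lo hi) ((xc : ℝ) / (2 * D * T)) a ≤ (lam : ℝ) * (z - a) ^ 2) ∧
      (upper = false → (lam : ℝ) * (z - a) ^ 2 ≤ valHL F (centre D lo hi) ((xc : ℝ) / (2 * D * T)) z
        - valHL F (centre D lo hi) ((xc : ℝ) / (2 * D * T)) a - (z - a) * etaL F (centre D lo hi) ((xc : ℝ) / (2 * D * T)) a)
  | upper, [], lam, h => by
    simp only [lamPiece, Option.some.injEq] at h
    subst h
    simp [valHL, etaL]
  | upper, f :: F, lam, h => by
    simp only [lamPiece] at h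
    by_cases hsg : ¬ (0 < wAt (2 * D * T) T lo hi xc zden za f * wAt (2 * D * T) T lo hi xc zden zb f ∧ (f.sg = 1 ∨ f.sg = -1))
    · rw [if_pos hsg] at h; simp at h
    rw [if_neg hsg] at h
    push Not at hsg
    obtain ⟨hpos, hsg1⟩ := hsg
    split at h
    · simp at h
    rename_i acc hacc
    simp only [Option.some.injEq] at h
    subst h
    obtain ⟨IH1, IH2⟩ := lamPiece_sound hD hT lo hi xc hzden ha hz upper F hacc
    obtain ⟨bu, bl⟩ := kform_tanD_bounds hD hT lo hi xc hzden f hsg1 hpos ha hz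
    set X := (xc : ℝ) / (2 * D * T) with hX
    set c := centre D lo hi with hc
    have hmv : mval f c X = (mcN T lo hi xc f : ℝ) / (2 * D * T) := by
      rw [hc, hX, ← mval_centre hD hT lo hi xc f]; field_simp
    have eΔ : ((f.bp : ℝ) + z * mval f c X) - ((f.bp : ℝ) + a * mval f c X) = (z - a) * mval f c X := by ring
    have esum : valHL (f :: F) c X z - valHL (f :: F) c X a - (z - a) * etaL (f :: F) c X a
        = (f.sg : ℝ) * tanD ((f.bp : ℝ) + a * mval f c X) ((f.bp : ℝ) + z * mval f c X)
          + (valHL F c X z - valHL F c X a - (z - a) * etaL F c X a) := by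
      rw [valHL_cons, valHL_cons, etaL_cons]; unfold tanD; ring
    rw [esum]
    rw [eΔ] at bu bl
    push_cast at bu bl
    cases upper with
    | true =>
      refine ⟨fun _ => ?_, fun h => absurd h (by simp)⟩
      have h2 := IH1 rfl
      simp only [if_true]
      push_cast
      rw [← hmv]
      have e : ∀ ρ : ℝ, (ρ * mval f c X * mval f c X) * (z - a) ^ 2 = ρ * ((z - a) * mval f c X) ^ 2 := fun ρ => by ring
      rw [add_mul, e]
      linarith [bu, h2]
    | false =>
      refine ⟨fun h => absurd h (by simp), fun _ => ?_⟩
      have h2 := IH2 rfl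
      simp only [Bool.false_eq_true, if_false]
      push_cast
      rw [← hmv]
      have e : ∀ ρ : ℝ, (ρ * mval f c X * mval f c X) * (z - a) ^ 2 = ρ * ((z - a) * mval f c X) ^ 2 := fun ρ => by ring
      rw [add_mul, e]
      linarith [bl, h2]

end FarSlice

end Summit.KontsevichZagierPeriods.Zeta5Search.Barrier.ConeGamma
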